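import Summits.Ventures.HSemireg.AmplificationChainG4SigmaTransport
import Summits.Ventures.HSemireg.AmplificationChainEtaleFamily
import Summits.Ventures.HSemireg.AmplificationChainVersalChart
import HarnessLib

/-!
# Venture HSemireg — the g = 4 σ-certificate MONDAY FORM on each rung of the (E)+(C) trust-base LADDER
# (seat p7, «assembly»: one-line compositions of seat p7's `_of_local_ff_single` row with theory seat 3's rungs)

HONEST FRAMING. Lean index of the computation cell `pub-hsemireg` (seat p7, «assembly»). Nothing about any explicit variety is
asserted; every published input is a hypothesis BY NAME; the object and its numbers are BY VALUE from the census. Nothing here says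
HC, HC_CM or HC_AV is proved; the g = 4 split case is IN PRINT ([Markman2023GeneralizedKummers] Thm. 1.5 (= Thm. 13.4; J. Eur. Math. Soc. 25 (2023) p. 236; pre-publication arXiv numbering: Thm. 1.3)) and is RE-DERIVED modulo the
named hypotheses. Theorems only: 0 `def`, 0 `sorry`, no new named fact; every proof is a one-line composition of LANDED theorems.

## The ladder (theory seat 3's P6 table; every rung: same BY-VALUE census object, same conclusion, same reach fact)

The σ-certificate row's ONE deformation/algebraisation input is named, from coarse to fine:

* R0 `hD : PerfectComplexDeformsOverEtaleNbhd C sigmaAdmissible` (theory seat 3; one assembled assumption) —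
  `weilFourfoldsSplit_of_reach_of_sigmaDeformsOverEtaleNbhd_of_local_ff_single` (`AmplificationChainG4SigmaTransport.lean` §1);
* R1 `PridhamPerfectLifts C ∧ PerfectComplexAlgebraisesLifts C` (seat p7: the printed Hodge-theoretic statement (F) split from the
  Hodge-free algebraisation (E)+(C), CLASS level) — `…_of_pridhamPerfect_of_algebraisesLifts_of_local_ff_single` (ibid. §2);
* R2 `PridhamPerfectLifts C ∧ (∀ smooth projective π over a smooth base, PerfectLiftsAlgebraise π)` (theory seat 3,
  `AmplificationChainEtaleFamily.lean`: (E)+(C) at the OBJECT level and `C`-free; OBJECT ⟹ CLASSES is KERNEL) — THIS FILE §1;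
* R3 `PridhamPerfectLifts C ∧ EGAIV_etaleQuasiSection_of_liftsSmallExtensions ∧ (Lieblich-type versal charts)` with the (D3)–(D5)
  composition KERNEL (theory seat 3, `AmplificationChainVersalChart.lean`) — §2 of this file, appended when that file is in the tree.

Kernel implications R3 ⟹ R2 ⟹ R1 ⟹ R0 are theorems of those files; a LOWER rung is a FINER provenance of the SAME input, never a
stronger claim. (F) `PridhamPerfectLifts C` is untouched on every rung: the PRINTED, REFEREED statement [Pridham2024Semiregularity]
Cor. 2.25 + Rem. 2.27 + Rem. 2.21 + Lemma 1.8–1.9 for strictly perfect complexes, typed VENTURE-side on target seat 7's real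
`σ`-carrier — NOT a Literature fact, undischarged, a hypothesis BY NAME (wording rule of referee 3: the refereed object is the paper).

## What §1 adds

`weilFourfoldsSplit_of_reach_of_pridhamPerfect_of_perfectLiftsAlgebraise_of_local_ff_single` — seat p7's recommended Monday form
(SHEAF source `G₀ = I_Z`, LOCAL full faithfulness of `Φ` in degrees `≤ 0`, `σ` on the object; `Ext^{<0} = 0` discharged on the source
and transported by the bijectivity clause in degrees `≤ 0`, red-5 W-8) with R1's class-level `PerfectComplexAlgebraisesLifts C`
replaced by R2's object-level, `C`-free `PerfectLiftsAlgebraise π` (theory seat 3's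
`perfectComplexAlgebraisesLifts_of_perfectLiftsAlgebraise`, PROVED); and the schema-level twin `…_of_hyperbolicSeedOn` (any
hyperbolic seed of the σ-class). Every BY-VALUE binder is verbatim R1's.

References: [Markman2023GeneralizedKummers] JEMS 25 (2023) Thm. 1.5 (= Thm. 13.4), p. 236 (pre-publication arXiv numbering: Thm. 1.3) (the case in print) · [Pridham2024Semiregularity] Forum Math.
Sigma 12 (2024) e126, Cor. 2.25, Rem. 2.27, Rem. 2.21, Lemma 1.8–1.9 · [Perry2022] Compositio Math. 158 (2022), proof of Prop. 8.1 ·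
[Lieblich2006] Thm. 4.2.1, Prop. 2.1.9 · [EGAIV4] Prop. 17.14.2, Cor. 17.16.3 (i) · [ThomasonTrobaugh1990] Prop. 2.3.1 (d) ·
[BuchweitzFlenner2003] Def. 4.1, §5 · [Orlov2002DerivedAbelian] Assertion 2.8 · [GortzWedhorn2023] Thm. 22.42 ·
[Deligne1982HodgeCycles] proof of Thm. 4.8 (reach).
-/

noncomputable section

open CategoryTheory AlgebraicGeometry Set
open Literature.AlgebraicGeometry.Motives Literature.AlgebraicGeometry.HodgeTheory
open Literature.AlgebraicGeometry.ModuliOfAbelianVarieties Literature.AlgebraicGeometry.Deligne1982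
open Literature.AlgebraicGeometry.KTheory
open Literature.AlgebraicTopology.SingularHomology
open Literature.AlgebraicGeometry.Morphisms (EGAIV_etaleQuasiSection_of_liftsSmallExtensions
  EGAIV4_smoothAt_of_liftsAlongSmallExtensions EGAIV_etaleQuasiSection_of_liftsSmallExtensions_of_smoothAt
  EGAIV4_smoothAt_of_liftsAlongSmallExtensions_holds)

namespace Summit.Ventures.HSemireg

open Summit.HodgeConjecture.HodgeConjecture
open Summit.HodgeConjecture.HodgeConjecture.WeilTypeLadder
open Summit.HodgeConjecture.HodgeConjecture.Cruxes.HodgeAbelianVarieties.EStepSecantInduction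
open Summit.Ventures.HSemireg.GeneralStructure

variable {C : ChernCharacterBetti}

/-! ## §1 Rung R2: (F) `PridhamPerfectLifts C` ∧ the OBJECT-LEVEL, `C`-free algebraisation `PerfectLiftsAlgebraise π` -/

/-- **g = 4, σ-TIER, rung R2 — the Monday form with the Hodge-free half at the OBJECT level.** BY NAME:
`weilFamilyReach_hyperbolic` (Deligne, refereed tree fact); `PridhamPerfectLifts C` (the PRINTED, REFEREED statement
[Pridham2024Semiregularity] Cor. 2.25 + Rem. 2.27 + Rem. 2.21 + Lemma 1.8–1.9 for strictly perfect complexes, typed VENTURE-side on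
target seat 7's real `σ`-carrier — NOT a Literature fact, undischarged, a hypothesis BY NAME); and, in place of the class-level
`PerfectComplexAlgebraisesLifts C`, theory seat 3's OBJECT-level, `C`-free `PerfectLiftsAlgebraise π` for every smooth projective `π`
over a smooth base (a derived-liftable universally gluable bounded complex of vector bundles extends, up to quasi-isomorphism at the
marked point, over an ÉTALE neighbourhood — the printed conclusion shape of [Perry2022] proof of Prop. 8.1; Hodge-free; kernel-linked
to nothing; OBJECT ⟹ CLASSES is the KERNEL theorem `perfectComplexAlgebraisesLifts_of_perfectLiftsAlgebraise`). BY VALUE, verbatim rung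
R1 (`weilFourfoldsSplit_of_reach_of_pridhamPerfect_of_algebraisesLifts_of_local_ff_single`): the split CM anchor `(P, ψ₀, e, a)` and
hyperbolicity (I4); `w ≠ 0` rational in the Weil plane and the Chern data `hch2 / hchp` (I3); `I ⊇ {1,2,3,4}`; the bounded complex of
vector bundles `E` on `P.X` in `[a', b']` with `(σ_q(E))_{q+1∈I}` JOINTLY INJECTIVE (`hσ`, the census σ-rank); the SHEAF `G₀ = I_Z` on
`Y₀ = X × X` with `Φ(Q G₀[0]) ≅ Q E`, `Φ.map` bijective on the self-Homs of `Q G₀[0]` in degrees `n ≤ 0` and `extRank Y₀ G₀[0] 0 = 1`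
(«`I_Z` simple», (I1)); `Ext^{<0}(E,E) = 0` is discharged on the SOURCE (a sheaf) and transported by the bijectivity clause in degrees
`≤ 0`. Conclusion: `Stubs.WeilAlgebraicSplitHyperplane 2 d` — the Weil classes of EVERY abelian fourfold of the split `ℚ(√-d)`-Weil
component are algebraic (in print: [Markman2023GeneralizedKummers] Thm. 1.5 (= Thm. 13.4; J. Eur. Math. Soc. 25 (2023) p. 236; pre-publication arXiv numbering: Thm. 1.3); re-derived, no new case).
[cite: Markman2023GeneralizedKummers, Theorem 1.5 (= Theorem 13.4), p. 236 (the case in print; arXiv:1805.11574 pre-publication numbering: Theorem 1.3)] [cite: Pridham2024Semiregularity, Cor. 2.25; Rem. 2.27; Rem. 2.21; Lemma 1.8–1.9]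
[cite: Perry2022, proof of Prop. 8.1] [cite: Lieblich2006, Thm. 4.2.1] [cite: BuchweitzFlenner2003, Def. 4.1 and §5 (I-semiregular)]
[cite: Orlov2002DerivedAbelian, Assertion 2.8] [cite: GortzWedhorn2023, Thm. 22.42] [cite: Deligne1982HodgeCycles, proof of Thm. 4.8] -/
theorem weilFourfoldsSplit_of_reach_of_pridhamPerfect_of_perfectLiftsAlgebraise_of_local_ff_single (hF : weilFamilyReach_hyperbolic)
    (hP : PridhamPerfectLifts C)
    (hA : ∀ ⦃𝒳 S : SchemeOver ℂ⦄ (π : 𝒳 ⟶ S) (n : ℕ),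
      IsSmoothProjectiveFamily π n → _root_.AlgebraicGeometry.Smooth S.hom → PerfectLiftsAlgebraise π)
    {d : ℕ} (hd : 0 < d)
    (P : AbelianVariety ℂ) (ψ₀ : P ⟶ P) (e : ProjectiveEmbedding P.X) (a : complexBetti (projectiveSpace e.n ℂ) 2)
    (hP4 : P.dim = 2 * 2) (hψ : ψ₀ ≫ ψ₀ = -(d • 𝟙 P)) (ha : IsRationalClass a) (ha0 : a ≠ 0)
    (hhyp : IsHyperbolicWeilType P ψ₀ 2 (symmetrisedClass d P ψ₀ e a))
    (w : complexBetti P.X (2 * 2)) (hwW : w ∈ weilClassesOf P ψ₀ 2 d) (hwr : IsRationalClass w) (hw0 : w ≠ 0)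
    (I : Finset ℕ) (hI : ∀ p : ℕ, 1 ≤ p → p ≤ 2 * 2 → p ∈ I) (E : CochainComplex P.X.left.Modules ℤ)
    (hE : IsBoundedVBComplex E) (a' b' : ℤ) [E.IsStrictlyGE a'] [E.IsStrictlyLE b']
    (hσ : letI := HasDerivedCategory.standard P.X.left.Modules
      HomComplex.IsISemiregularC P.X E a' b' hE.isFiniteLocallyFree {q | q + 1 ∈ I})
    (q : ℚ) (c : ℕ → ℚ)
    (hch2 : chPerfect C P.X E hE.isFiniteLocallyFree 2 = ((q : ℚ) : ℂ) • cupPowTwo (symmetrisedClass d P ψ₀ e a) 2 + w)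
    (hchp : ∀ p ∈ I, p ≠ 2 →
      chPerfect C P.X E hE.isFiniteLocallyFree p = ((c p : ℚ) : ℂ) • cupPowTwo (symmetrisedClass d P ψ₀ e a) p)
    {Y₀ : SchemeOver ℂ} (G₀ : Y₀.left.Modules) :
    letI := HasDerivedCategory.standard Y₀.left.Modules
    letI := HasDerivedCategory.standard P.X.left.Modules
    ∀ (Φ : DerivedCategory Y₀.left.Modules ⥤ DerivedCategory P.X.left.Modules) [Φ.Additive] [Φ.Linear ℂ]
      [Φ.CommShift ℤ]
      (_ : Φ.obj (DerivedCategory.Q.obj ((CochainComplex.singleFunctor Y₀.left.Modules 0).obj G₀)) ≅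
        DerivedCategory.Q.obj E),
      (∀ n : ℤ, n ≤ 0 → Function.Bijective
        (fun f : (DerivedCategory.Q.obj ((CochainComplex.singleFunctor Y₀.left.Modules 0).obj G₀) ⟶
          (DerivedCategory.Q.obj ((CochainComplex.singleFunctor Y₀.left.Modules 0).obj G₀))⟦n⟧) ↦ Φ.map f)) →
      extRank Y₀ ((CochainComplex.singleFunctor Y₀.left.Modules 0).obj G₀) 0 = 1 →
      Stubs.WeilAlgebraicSplitHyperplane 2 d :=
  weilFourfoldsSplit_of_reach_of_pridhamPerfect_of_algebraisesLifts_of_local_ff_single hF hP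
    (perfectComplexAlgebraisesLifts_of_perfectLiftsAlgebraise hA C) hd P ψ₀ e a hP4 hψ ha ha0 hhyp w hwW hwr hw0 I hI E hE a' b' hσ
    q c hch2 hchp G₀

/-- **Schema level on rung R2** (any hyperbolic seed of the σ-class): reach ∧ (F) `PridhamPerfectLifts C` ∧ (object-level (E)+(C))
`PerfectLiftsAlgebraise π` for every smooth projective `π` over a smooth base ∧ `HasHyperbolicSeedOn (sigmaObjClass C) 2 d` ⟹
`Stubs.WeilAlgebraicSplitHyperplane 2 d`. [cite: Markman2023GeneralizedKummers, Theorem 1.5 (= Theorem 13.4), p. 236 (the case in print; arXiv:1805.11574 pre-publication numbering: Theorem 1.3)]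
[cite: Pridham2024Semiregularity, Cor. 2.25; Rem. 2.27] [cite: Perry2022, proof of Prop. 8.1] [cite: Deligne1982HodgeCycles, proof of Thm. 4.8] -/
theorem weilFourfoldsSplit_of_reach_of_pridhamPerfect_of_perfectLiftsAlgebraise_of_hyperbolicSeedOn (hF : weilFamilyReach_hyperbolic)
    (hP : PridhamPerfectLifts C)
    (hA : ∀ ⦃𝒳 S : SchemeOver ℂ⦄ (π : 𝒳 ⟶ S) (n : ℕ),
      IsSmoothProjectiveFamily π n → _root_.AlgebraicGeometry.Smooth S.hom → PerfectLiftsAlgebraise π)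
    {d : ℕ} (hd : 0 < d) (hS : HasHyperbolicSeedOn (sigmaObjClass C) 2 d) : Stubs.WeilAlgebraicSplitHyperplane 2 d :=
  weilFourfoldsSplit_of_reach_of_pridhamPerfect_of_algebraisesLifts_of_hyperbolicSeedOn hF hP
    (perfectComplexAlgebraisesLifts_of_perfectLiftsAlgebraise hA C) hd hS

/-! ## §2 (appended) Rung R3: (F) `PridhamPerfectLifts C` ∧ [EGAIV4] 17.14.2 + 17.16.3 (i) (Literature named fact) ∧ Lieblich-type
VERSAL CHARTS, the (D3)–(D5) composition KERNEL (theory seat 3's `AmplificationChainVersalChart.lean`) -/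

/-- **g = 4, σ-TIER, rung R3 — the Monday form with the Hodge-free half on CITED inputs + kernel glue.** BY NAME:
`weilFamilyReach_hyperbolic` (Deligne, refereed tree fact); `PridhamPerfectLifts C` (the PRINTED, REFEREED statement
[Pridham2024Semiregularity] Cor. 2.25 + Rem. 2.27 + Rem. 2.21 + Lemma 1.8–1.9 for strictly perfect complexes, typed VENTURE-side on
target seat 7's real `σ`-carrier — NOT a Literature fact, undischarged, a hypothesis BY NAME); the Literature named fact
`EGAIV_etaleQuasiSection_of_liftsSmallExtensions` ([EGAIV4] Prop. 17.14.2 + Cor. 17.16.3 (i), `ℂ`-scheme special case, weaker than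
print; classical); and Lieblich-type VERSAL CHARTS — `HasVersalPerfectChartAt` for every universally gluable bounded complex of vector
bundles on every smooth projective family over a smooth base (theory seat 3's predicate; the chart-level corollary of [Lieblich2006]
Thm. 4.2.1 + Prop. 2.1.9 with [StacksProject] 0DNZ and [ThomasonTrobaugh1990] 2.3.1 (d) — an ASSEMBLED seat corollary, NOT one printed
sentence; assumption by name, kernel-linked to nothing; PRECISION (red-5 W-14): the predicate's versality clause is typed in EXISTENCE form — implied by, and WEAKER than, formal smoothness of a Lieblich atlas at the chart point, which is NOT consumed anywhere on this ladder (READING NOTE in theory seat 3's `AmplificationChainVersalChartWitness.lean`)). The glue (D3)–(D5) — versality + seat p7's derived lifting property ⟹ the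
infinitesimal criterion at the chart point; EGA ⟹ pointed étale quasi-section; pull-back of the versal complex — is theory seat 3's
KERNEL theorem `perfectLiftsAlgebraise_of_versalCharts`, and OBJECT ⟹ CLASSES is `perfectComplexAlgebraisesLifts_of_perfectLiftsAlgebraise`.
BY VALUE, verbatim rung R1 (`weilFourfoldsSplit_of_reach_of_pridhamPerfect_of_algebraisesLifts_of_local_ff_single`): the split CM anchor
`(P, ψ₀, e, a)` and hyperbolicity (I4); `w ≠ 0` rational in the Weil plane and the Chern data (I3); `I ⊇ {1,2,3,4}`; the bounded complex
of vector bundles `E` on `P.X` in `[a', b']` with `(σ_q(E))_{q+1∈I}` JOINTLY INJECTIVE (`hσ`, the census σ-rank); the SHEAF `G₀ = I_Z` on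
`Y₀ = X × X` with `Φ(Q G₀[0]) ≅ Q E`, `Φ.map` bijective on the self-Homs of `Q G₀[0]` in degrees `n ≤ 0` and `extRank Y₀ G₀[0] 0 = 1`
(«`I_Z` simple», (I1)); `Ext^{<0}(E,E) = 0` discharged on the SOURCE and transported by the bijectivity clause in degrees `≤ 0`.
Conclusion: `Stubs.WeilAlgebraicSplitHyperplane 2 d` (in print: [Markman2023GeneralizedKummers] Thm. 1.5 (= Thm. 13.4; J. Eur. Math. Soc. 25 (2023) p. 236; pre-publication arXiv numbering: Thm. 1.3); re-derived, no new case).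
[cite: Markman2023GeneralizedKummers, Theorem 1.5 (= Theorem 13.4), p. 236 (the case in print; arXiv:1805.11574 pre-publication numbering: Theorem 1.3)] [cite: Pridham2024Semiregularity, Cor. 2.25; Rem. 2.27; Rem. 2.21; Lemma 1.8–1.9]
[cite: EGAIV4, Prop. 17.14.2 and Cor. 17.16.3 (i)] [cite: Lieblich2006, Thm. 4.2.1 and Prop. 2.1.9] [cite: Perry2022, proof of Prop. 8.1]
[cite: BuchweitzFlenner2003, Def. 4.1 and §5 (I-semiregular)] [cite: Orlov2002DerivedAbelian, Assertion 2.8] [cite: GortzWedhorn2023, Thm. 22.42]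
[cite: Deligne1982HodgeCycles, proof of Thm. 4.8] -/
theorem weilFourfoldsSplit_of_reach_of_pridhamPerfect_of_versalCharts_of_EGA_of_local_ff_single (hF : weilFamilyReach_hyperbolic)
    (hP : PridhamPerfectLifts C) (hEGA : EGAIV_etaleQuasiSection_of_liftsSmallExtensions)
    (hV : ∀ ⦃𝒳 S : SchemeOver ℂ⦄ (π : 𝒳 ⟶ S) (n : ℕ),
      IsSmoothProjectiveFamily π n → _root_.AlgebraicGeometry.Smooth S.hom →
      ∀ (s₀ : ComplexPoints S) (X₀ : SchemeOver ℂ) (e : X₀ ≅ fiberOver π s₀)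
        (E : CochainComplex X₀.left.Modules ℤ), IsBoundedVBComplex E →
        (∀ k : ℤ, k < 0 → extRank X₀ E k = 0) → HasVersalPerfectChartAt π s₀ X₀ e E)
    {d : ℕ} (hd : 0 < d)
    (P : AbelianVariety ℂ) (ψ₀ : P ⟶ P) (e : ProjectiveEmbedding P.X) (a : complexBetti (projectiveSpace e.n ℂ) 2)
    (hP4 : P.dim = 2 * 2) (hψ : ψ₀ ≫ ψ₀ = -(d • 𝟙 P)) (ha : IsRationalClass a) (ha0 : a ≠ 0)
    (hhyp : IsHyperbolicWeilType P ψ₀ 2 (symmetrisedClass d P ψ₀ e a))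
    (w : complexBetti P.X (2 * 2)) (hwW : w ∈ weilClassesOf P ψ₀ 2 d) (hwr : IsRationalClass w) (hw0 : w ≠ 0)
    (I : Finset ℕ) (hI : ∀ p : ℕ, 1 ≤ p → p ≤ 2 * 2 → p ∈ I) (E : CochainComplex P.X.left.Modules ℤ)
    (hE : IsBoundedVBComplex E) (a' b' : ℤ) [E.IsStrictlyGE a'] [E.IsStrictlyLE b']
    (hσ : letI := HasDerivedCategory.standard P.X.left.Modules
      HomComplex.IsISemiregularC P.X E a' b' hE.isFiniteLocallyFree {q | q + 1 ∈ I})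
    (q : ℚ) (c : ℕ → ℚ)
    (hch2 : chPerfect C P.X E hE.isFiniteLocallyFree 2 = ((q : ℚ) : ℂ) • cupPowTwo (symmetrisedClass d P ψ₀ e a) 2 + w)
    (hchp : ∀ p ∈ I, p ≠ 2 →
      chPerfect C P.X E hE.isFiniteLocallyFree p = ((c p : ℚ) : ℂ) • cupPowTwo (symmetrisedClass d P ψ₀ e a) p)
    {Y₀ : SchemeOver ℂ} (G₀ : Y₀.left.Modules) :
    letI := HasDerivedCategory.standard Y₀.left.Modules
    letI := HasDerivedCategory.standard P.X.left.Modules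
    ∀ (Φ : DerivedCategory Y₀.left.Modules ⥤ DerivedCategory P.X.left.Modules) [Φ.Additive] [Φ.Linear ℂ]
      [Φ.CommShift ℤ]
      (_ : Φ.obj (DerivedCategory.Q.obj ((CochainComplex.singleFunctor Y₀.left.Modules 0).obj G₀)) ≅
        DerivedCategory.Q.obj E),
      (∀ n : ℤ, n ≤ 0 → Function.Bijective
        (fun f : (DerivedCategory.Q.obj ((CochainComplex.singleFunctor Y₀.left.Modules 0).obj G₀) ⟶
          (DerivedCategory.Q.obj ((CochainComplex.singleFunctor Y₀.left.Modules 0).obj G₀))⟦n⟧) ↦ Φ.map f)) →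
      extRank Y₀ ((CochainComplex.singleFunctor Y₀.left.Modules 0).obj G₀) 0 = 1 →
      Stubs.WeilAlgebraicSplitHyperplane 2 d :=
  weilFourfoldsSplit_of_reach_of_pridhamPerfect_of_algebraisesLifts_of_local_ff_single hF hP
    (perfectComplexAlgebraisesLifts_of_versalCharts_of_EGA hEGA hV C) hd P ψ₀ e a hP4 hψ ha ha0 hhyp w hwW hwr hw0 I hI E hE a' b' hσ
    q c hch2 hchp G₀

/-- **Schema level on rung R3** (any hyperbolic seed of the σ-class): reach ∧ (F) `PridhamPerfectLifts C` ∧ the EGA IV 17 fact ∧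
Lieblich-type versal charts ∧ `HasHyperbolicSeedOn (sigmaObjClass C) 2 d` ⟹ `Stubs.WeilAlgebraicSplitHyperplane 2 d`.
[cite: Markman2023GeneralizedKummers, Theorem 1.5 (= Theorem 13.4), p. 236 (the case in print; arXiv:1805.11574 pre-publication numbering: Theorem 1.3)] [cite: Pridham2024Semiregularity, Cor. 2.25; Rem. 2.27]
[cite: EGAIV4, Prop. 17.14.2 and Cor. 17.16.3 (i)] [cite: Lieblich2006, Thm. 4.2.1] [cite: Deligne1982HodgeCycles, proof of Thm. 4.8] -/
theorem weilFourfoldsSplit_of_reach_of_pridhamPerfect_of_versalCharts_of_EGA_of_hyperbolicSeedOn (hF : weilFamilyReach_hyperbolic)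
    (hP : PridhamPerfectLifts C) (hEGA : EGAIV_etaleQuasiSection_of_liftsSmallExtensions)
    (hV : ∀ ⦃𝒳 S : SchemeOver ℂ⦄ (π : 𝒳 ⟶ S) (n : ℕ),
      IsSmoothProjectiveFamily π n → _root_.AlgebraicGeometry.Smooth S.hom →
      ∀ (s₀ : ComplexPoints S) (X₀ : SchemeOver ℂ) (e : X₀ ≅ fiberOver π s₀)
        (E : CochainComplex X₀.left.Modules ℤ), IsBoundedVBComplex E →
        (∀ k : ℤ, k < 0 → extRank X₀ E k = 0) → HasVersalPerfectChartAt π s₀ X₀ e E)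
    {d : ℕ} (hd : 0 < d) (hS : HasHyperbolicSeedOn (sigmaObjClass C) 2 d) : Stubs.WeilAlgebraicSplitHyperplane 2 d :=
  weilFourfoldsSplit_of_reach_of_pridhamPerfect_of_algebraisesLifts_of_hyperbolicSeedOn hF hP
    (perfectComplexAlgebraisesLifts_of_versalCharts_of_EGA hEGA hV C) hd hS

/-! ## §3 (appended) Rung R4: as R3 with the merged EGA fact replaced by ONE printed statement, [EGAIV4] Prop. (17.14.2)
(`EGAIV4_smoothAt_of_liftsAlongSmallExtensions`, seat lit-3), Cor. (17.16.3) (i) being PROVED from Mathlib (`etaleQuasiSection_of_smooth`) -/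

/-- **g = 4, σ-TIER, rung R4 — the Monday form on the FINEST trust base on offer.** BY NAME: `weilFamilyReach_hyperbolic` (Deligne,
refereed tree fact); `PridhamPerfectLifts C` (the PRINTED, REFEREED statement [Pridham2024Semiregularity] Cor. 2.25 + Rem. 2.27 + Rem. 2.21 +
Lemma 1.8–1.9 for strictly perfect complexes, typed VENTURE-side on target seat 7's real `σ`-carrier — NOT a Literature fact, undischarged, a
hypothesis BY NAME); the Literature named fact `EGAIV4_smoothAt_of_liftsAlongSmallExtensions` = [EGAIV4] Prop. (17.14.2) ALONE («il suffit»,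
case «lisse», with Déf. (17.3.7); `ℂ`-schemes, a `ℂ`-point; ONE printed classical statement, seat lit-3); and Lieblich-type VERSAL CHARTS
(`HasVersalPerfectChartAt` for every universally gluable bounded complex of vector bundles on every smooth projective family over a smooth base;
assembled seat corollary of [Lieblich2006] Thm. 4.2.1 + Prop. 2.1.9; assumption by name, kernel-linked to nothing; PRECISION (red-5 W-14): the predicate's versality clause is typed in EXISTENCE form — implied by, and WEAKER than, formal smoothness of a Lieblich atlas at the chart point, which is NOT consumed anywhere on this ladder (READING NOTE in theory seat 3's `AmplificationChainVersalChartWitness.lean`)). KERNEL: [EGAIV4] Cor.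
(17.16.3) (i) (seat lit-3's `etaleQuasiSection_of_smooth`, from Mathlib's «smooth = locally standard smooth = étale over `𝔸ⁿ`») and the glued
`EGAIV_etaleQuasiSection_of_liftsSmallExtensions_of_smoothAt`; theory seat 3's (D3)–(D5) `perfectLiftsAlgebraise_of_versalCharts` and OBJECT ⟹
CLASSES; seat p7's split; seat p6's `Ext`-transport; the σ-door, spread, engine and descent of the tree. BY VALUE, verbatim rung R1. Conclusion:
`Stubs.WeilAlgebraicSplitHyperplane 2 d` (in print: [Markman2023GeneralizedKummers] Thm. 1.5 (= Thm. 13.4; J. Eur. Math. Soc. 25 (2023) p. 236; pre-publication arXiv numbering: Thm. 1.3); re-derived, no new case).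
[cite: Markman2023GeneralizedKummers, Theorem 1.5 (= Theorem 13.4), p. 236 (the case in print; arXiv:1805.11574 pre-publication numbering: Theorem 1.3)] [cite: Pridham2024Semiregularity, Cor. 2.25; Rem. 2.27; Rem. 2.21; Lemma 1.8–1.9]
[cite: EGAIV4, Prop. (17.14.2), p. 98, and Cor. (17.16.3) (i), p. 106] [cite: Lieblich2006, Thm. 4.2.1 and Prop. 2.1.9] [cite: Perry2022, proof of Prop. 8.1]
[cite: BuchweitzFlenner2003, Def. 4.1 and §5 (I-semiregular)] [cite: Orlov2002DerivedAbelian, Assertion 2.8] [cite: GortzWedhorn2023, Thm. 22.42]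
[cite: Deligne1982HodgeCycles, proof of Thm. 4.8] -/
theorem weilFourfoldsSplit_of_reach_of_pridhamPerfect_of_versalCharts_of_EGAIV4smoothAt_of_local_ff_single
    (hF : weilFamilyReach_hyperbolic) (hP : PridhamPerfectLifts C) (hEGA : EGAIV4_smoothAt_of_liftsAlongSmallExtensions)
    (hV : ∀ ⦃𝒳 S : SchemeOver ℂ⦄ (π : 𝒳 ⟶ S) (n : ℕ),
      IsSmoothProjectiveFamily π n → _root_.AlgebraicGeometry.Smooth S.hom →
      ∀ (s₀ : ComplexPoints S) (X₀ : SchemeOver ℂ) (e : X₀ ≅ fiberOver π s₀)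
        (E : CochainComplex X₀.left.Modules ℤ), IsBoundedVBComplex E →
        (∀ k : ℤ, k < 0 → extRank X₀ E k = 0) → HasVersalPerfectChartAt π s₀ X₀ e E)
    {d : ℕ} (hd : 0 < d)
    (P : AbelianVariety ℂ) (ψ₀ : P ⟶ P) (e : ProjectiveEmbedding P.X) (a : complexBetti (projectiveSpace e.n ℂ) 2)
    (hP4 : P.dim = 2 * 2) (hψ : ψ₀ ≫ ψ₀ = -(d • 𝟙 P)) (ha : IsRationalClass a) (ha0 : a ≠ 0)
    (hhyp : IsHyperbolicWeilType P ψ₀ 2 (symmetrisedClass d P ψ₀ e a))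
    (w : complexBetti P.X (2 * 2)) (hwW : w ∈ weilClassesOf P ψ₀ 2 d) (hwr : IsRationalClass w) (hw0 : w ≠ 0)
    (I : Finset ℕ) (hI : ∀ p : ℕ, 1 ≤ p → p ≤ 2 * 2 → p ∈ I) (E : CochainComplex P.X.left.Modules ℤ)
    (hE : IsBoundedVBComplex E) (a' b' : ℤ) [E.IsStrictlyGE a'] [E.IsStrictlyLE b']
    (hσ : letI := HasDerivedCategory.standard P.X.left.Modules
      HomComplex.IsISemiregularC P.X E a' b' hE.isFiniteLocallyFree {q | q + 1 ∈ I})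
    (q : ℚ) (c : ℕ → ℚ)
    (hch2 : chPerfect C P.X E hE.isFiniteLocallyFree 2 = ((q : ℚ) : ℂ) • cupPowTwo (symmetrisedClass d P ψ₀ e a) 2 + w)
    (hchp : ∀ p ∈ I, p ≠ 2 →
      chPerfect C P.X E hE.isFiniteLocallyFree p = ((c p : ℚ) : ℂ) • cupPowTwo (symmetrisedClass d P ψ₀ e a) p)
    {Y₀ : SchemeOver ℂ} (G₀ : Y₀.left.Modules) :
    letI := HasDerivedCategory.standard Y₀.left.Modules
    letI := HasDerivedCategory.standard P.X.left.Modules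
    ∀ (Φ : DerivedCategory Y₀.left.Modules ⥤ DerivedCategory P.X.left.Modules) [Φ.Additive] [Φ.Linear ℂ]
      [Φ.CommShift ℤ]
      (_ : Φ.obj (DerivedCategory.Q.obj ((CochainComplex.singleFunctor Y₀.left.Modules 0).obj G₀)) ≅
        DerivedCategory.Q.obj E),
      (∀ n : ℤ, n ≤ 0 → Function.Bijective
        (fun f : (DerivedCategory.Q.obj ((CochainComplex.singleFunctor Y₀.left.Modules 0).obj G₀) ⟶
          (DerivedCategory.Q.obj ((CochainComplex.singleFunctor Y₀.left.Modules 0).obj G₀))⟦n⟧) ↦ Φ.map f)) →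
      extRank Y₀ ((CochainComplex.singleFunctor Y₀.left.Modules 0).obj G₀) 0 = 1 →
      Stubs.WeilAlgebraicSplitHyperplane 2 d :=
  weilFourfoldsSplit_of_reach_of_pridhamPerfect_of_versalCharts_of_EGA_of_local_ff_single hF hP
    (EGAIV_etaleQuasiSection_of_liftsSmallExtensions_of_smoothAt hEGA) hV hd P ψ₀ e a hP4 hψ ha ha0 hhyp w hwW hwr hw0 I hI E hE a' b'
    hσ q c hch2 hchp G₀

/-- **Schema level on rung R4** (any hyperbolic seed of the σ-class): reach ∧ (F) `PridhamPerfectLifts C` ∧ [EGAIV4] Prop. (17.14.2) ∧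
Lieblich-type versal charts ∧ `HasHyperbolicSeedOn (sigmaObjClass C) 2 d` ⟹ `Stubs.WeilAlgebraicSplitHyperplane 2 d`.
[cite: Markman2023GeneralizedKummers, Theorem 1.5 (= Theorem 13.4), p. 236 (the case in print; arXiv:1805.11574 pre-publication numbering: Theorem 1.3)] [cite: Pridham2024Semiregularity, Cor. 2.25; Rem. 2.27]
[cite: EGAIV4, Prop. (17.14.2), p. 98] [cite: Lieblich2006, Thm. 4.2.1] [cite: Deligne1982HodgeCycles, proof of Thm. 4.8] -/
theorem weilFourfoldsSplit_of_reach_of_pridhamPerfect_of_versalCharts_of_EGAIV4smoothAt_of_hyperbolicSeedOn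
    (hF : weilFamilyReach_hyperbolic) (hP : PridhamPerfectLifts C) (hEGA : EGAIV4_smoothAt_of_liftsAlongSmallExtensions)
    (hV : ∀ ⦃𝒳 S : SchemeOver ℂ⦄ (π : 𝒳 ⟶ S) (n : ℕ),
      IsSmoothProjectiveFamily π n → _root_.AlgebraicGeometry.Smooth S.hom →
      ∀ (s₀ : ComplexPoints S) (X₀ : SchemeOver ℂ) (e : X₀ ≅ fiberOver π s₀)
        (E : CochainComplex X₀.left.Modules ℤ), IsBoundedVBComplex E →
        (∀ k : ℤ, k < 0 → extRank X₀ E k = 0) → HasVersalPerfectChartAt π s₀ X₀ e E)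
    {d : ℕ} (hd : 0 < d) (hS : HasHyperbolicSeedOn (sigmaObjClass C) 2 d) : Stubs.WeilAlgebraicSplitHyperplane 2 d :=
  weilFourfoldsSplit_of_reach_of_pridhamPerfect_of_versalCharts_of_EGA_of_hyperbolicSeedOn hF hP
    (EGAIV_etaleQuasiSection_of_liftsSmallExtensions_of_smoothAt hEGA) hV hd hS

/-! ## §4 (appended) Rung R5: [EGAIV4] Prop. (17.14.2) is now PROVED in the tree (seat lit-3, Appendix B of
`EtaleQuasiSectionOfFormallySmooth.lean`: Mathlib's Jacobian criterion for local algebras + Artin–Rees, then the open smooth locus;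
`EGAIV4_smoothAt_of_liftsAlongSmallExtensions_holds`, `EGAIV_etaleQuasiSection_of_liftsSmallExtensions_holds`) — the EGA input of R3/R4 is
DISCHARGED in the kernel: the Hodge-free half (E)+(C) of the σ-row rests on Lieblich-type VERSAL CHARTS alone (the object- and
class-level EGA-free glue — versal charts ⟹ `PerfectLiftsAlgebraise π` ⟹ `PerfectComplexAlgebraisesLifts C` — is theory seat 3's lane,
filed separately; this file adds only the two ladder rows) -/

/-- **g = 4, σ-TIER, rung R5 — the Monday form with EGA IV 17 DISCHARGED.** BY NAME: `weilFamilyReach_hyperbolic` (Deligne, refereed tree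
fact); `PridhamPerfectLifts C` (the PRINTED, REFEREED statement [Pridham2024Semiregularity] Cor. 2.25 + Rem. 2.27 + Rem. 2.21 + Lemma 1.8–1.9 for
strictly perfect complexes, typed VENTURE-side on target seat 7's real `σ`-carrier — NOT a Literature fact, undischarged, a hypothesis BY NAME);
and Lieblich-type VERSAL CHARTS (`HasVersalPerfectChartAt` for every universally gluable bounded complex of vector bundles on every smooth
projective family over a smooth base; assembled seat corollary of [Lieblich2006] Thm. 4.2.1 + Prop. 2.1.9; assumption by name, kernel-linked to
nothing; PRECISION (red-5 W-14): the predicate's versality clause is typed in EXISTENCE form — implied by, and WEAKER than, formal smoothness of a Lieblich atlas at the chart point, which is NOT consumed anywhere on this ladder (READING NOTE in theory seat 3's `AmplificationChainVersalChartWitness.lean`)) — NOTHING ELSE: [EGAIV4] Prop. (17.14.2) is seat lit-3's THEOREM `EGAIV4_smoothAt_of_liftsAlongSmallExtensions_holds` (Jacobian criterion +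
Artin–Rees + open smooth locus, from Mathlib) and Cor. (17.16.3) (i) is `etaleQuasiSection_of_smooth`; theory seat 3's (D3)–(D5) and OBJECT ⟹
CLASSES, seat p7's split, seat p6's `Ext`-transport, the σ-door, spread, engine and descent are KERNEL. BY VALUE, verbatim rung R1
(`weilFourfoldsSplit_of_reach_of_pridhamPerfect_of_algebraisesLifts_of_local_ff_single`): the split CM anchor `(P, ψ₀, e, a)` and hyperbolicity
(I4); `w ≠ 0` rational in the Weil plane and the Chern data (I3); `I ⊇ {1,2,3,4}`; the bounded complex of vector bundles `E` on `P.X` in `[a', b']`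
with `(σ_q(E))_{q+1∈I}` JOINTLY INJECTIVE (`hσ`, the census σ-rank); the SHEAF `G₀ = I_Z` on `Y₀ = X × X` with `Φ(Q G₀[0]) ≅ Q E`, `Φ.map`
bijective on the self-Homs of `Q G₀[0]` in degrees `n ≤ 0` and `extRank Y₀ G₀[0] 0 = 1` («`I_Z` simple», (I1)); `Ext^{<0}(E,E) = 0` discharged on
the SOURCE and transported by the bijectivity clause in degrees `≤ 0`. Conclusion: `Stubs.WeilAlgebraicSplitHyperplane 2 d` (in print:
[Markman2023GeneralizedKummers] Thm. 1.5 (= Thm. 13.4; J. Eur. Math. Soc. 25 (2023) p. 236; pre-publication arXiv numbering: Thm. 1.3); re-derived, no new case). Proof: rung R4 at `hEGA := EGAIV4_smoothAt_of_liftsAlongSmallExtensions_holds`.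
[cite: Markman2023GeneralizedKummers, Theorem 1.5 (= Theorem 13.4), p. 236 (the case in print; arXiv:1805.11574 pre-publication numbering: Theorem 1.3)] [cite: Pridham2024Semiregularity, Cor. 2.25; Rem. 2.27; Rem. 2.21; Lemma 1.8–1.9]
[cite: Lieblich2006, Thm. 4.2.1 and Prop. 2.1.9] [cite: EGAIV4, Prop. (17.14.2), p. 98, and Cor. (17.16.3) (i), p. 106] [cite: Perry2022, proof of Prop. 8.1]
[cite: BuchweitzFlenner2003, Def. 4.1 and §5 (I-semiregular)] [cite: Orlov2002DerivedAbelian, Assertion 2.8] [cite: GortzWedhorn2023, Thm. 22.42]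
[cite: Deligne1982HodgeCycles, proof of Thm. 4.8] -/
theorem weilFourfoldsSplit_of_reach_of_pridhamPerfect_of_versalCharts_of_local_ff_single
    (hF : weilFamilyReach_hyperbolic) (hP : PridhamPerfectLifts C)
    (hV : ∀ ⦃𝒳 S : SchemeOver ℂ⦄ (π : 𝒳 ⟶ S) (n : ℕ),
      IsSmoothProjectiveFamily π n → _root_.AlgebraicGeometry.Smooth S.hom →
      ∀ (s₀ : ComplexPoints S) (X₀ : SchemeOver ℂ) (e : X₀ ≅ fiberOver π s₀)
        (E : CochainComplex X₀.left.Modules ℤ), IsBoundedVBComplex E →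
        (∀ k : ℤ, k < 0 → extRank X₀ E k = 0) → HasVersalPerfectChartAt π s₀ X₀ e E)
    {d : ℕ} (hd : 0 < d)
    (P : AbelianVariety ℂ) (ψ₀ : P ⟶ P) (e : ProjectiveEmbedding P.X) (a : complexBetti (projectiveSpace e.n ℂ) 2)
    (hP4 : P.dim = 2 * 2) (hψ : ψ₀ ≫ ψ₀ = -(d • 𝟙 P)) (ha : IsRationalClass a) (ha0 : a ≠ 0)
    (hhyp : IsHyperbolicWeilType P ψ₀ 2 (symmetrisedClass d P ψ₀ e a))
    (w : complexBetti P.X (2 * 2)) (hwW : w ∈ weilClassesOf P ψ₀ 2 d) (hwr : IsRationalClass w) (hw0 : w ≠ 0)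
    (I : Finset ℕ) (hI : ∀ p : ℕ, 1 ≤ p → p ≤ 2 * 2 → p ∈ I) (E : CochainComplex P.X.left.Modules ℤ)
    (hE : IsBoundedVBComplex E) (a' b' : ℤ) [E.IsStrictlyGE a'] [E.IsStrictlyLE b']
    (hσ : letI := HasDerivedCategory.standard P.X.left.Modules
      HomComplex.IsISemiregularC P.X E a' b' hE.isFiniteLocallyFree {q | q + 1 ∈ I})
    (q : ℚ) (c : ℕ → ℚ)
    (hch2 : chPerfect C P.X E hE.isFiniteLocallyFree 2 = ((q : ℚ) : ℂ) • cupPowTwo (symmetrisedClass d P ψ₀ e a) 2 + w)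
    (hchp : ∀ p ∈ I, p ≠ 2 →
      chPerfect C P.X E hE.isFiniteLocallyFree p = ((c p : ℚ) : ℂ) • cupPowTwo (symmetrisedClass d P ψ₀ e a) p)
    {Y₀ : SchemeOver ℂ} (G₀ : Y₀.left.Modules) :
    letI := HasDerivedCategory.standard Y₀.left.Modules
    letI := HasDerivedCategory.standard P.X.left.Modules
    ∀ (Φ : DerivedCategory Y₀.left.Modules ⥤ DerivedCategory P.X.left.Modules) [Φ.Additive] [Φ.Linear ℂ]
      [Φ.CommShift ℤ]
      (_ : Φ.obj (DerivedCategory.Q.obj ((CochainComplex.singleFunctor Y₀.left.Modules 0).obj G₀)) ≅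
        DerivedCategory.Q.obj E),
      (∀ n : ℤ, n ≤ 0 → Function.Bijective
        (fun f : (DerivedCategory.Q.obj ((CochainComplex.singleFunctor Y₀.left.Modules 0).obj G₀) ⟶
          (DerivedCategory.Q.obj ((CochainComplex.singleFunctor Y₀.left.Modules 0).obj G₀))⟦n⟧) ↦ Φ.map f)) →
      extRank Y₀ ((CochainComplex.singleFunctor Y₀.left.Modules 0).obj G₀) 0 = 1 →
      Stubs.WeilAlgebraicSplitHyperplane 2 d :=
  weilFourfoldsSplit_of_reach_of_pridhamPerfect_of_versalCharts_of_EGAIV4smoothAt_of_local_ff_single hF hP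
    EGAIV4_smoothAt_of_liftsAlongSmallExtensions_holds hV hd P ψ₀ e a hP4 hψ ha ha0 hhyp w hwW hwr hw0 I hI E hE a' b' hσ q c hch2
    hchp G₀

/-- **Schema level on rung R5** (any hyperbolic seed of the σ-class): reach ∧ (F) `PridhamPerfectLifts C` ∧ Lieblich-type versal charts ∧
`HasHyperbolicSeedOn (sigmaObjClass C) 2 d` ⟹ `Stubs.WeilAlgebraicSplitHyperplane 2 d`; EGA IV 17 discharged in the kernel.
[cite: Markman2023GeneralizedKummers, Theorem 1.5 (= Theorem 13.4), p. 236 (the case in print; arXiv:1805.11574 pre-publication numbering: Theorem 1.3)] [cite: Pridham2024Semiregularity, Cor. 2.25; Rem. 2.27]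
[cite: Lieblich2006, Thm. 4.2.1] [cite: EGAIV4, Prop. (17.14.2), p. 98] [cite: Deligne1982HodgeCycles, proof of Thm. 4.8] -/
theorem weilFourfoldsSplit_of_reach_of_pridhamPerfect_of_versalCharts_of_hyperbolicSeedOn
    (hF : weilFamilyReach_hyperbolic) (hP : PridhamPerfectLifts C)
    (hV : ∀ ⦃𝒳 S : SchemeOver ℂ⦄ (π : 𝒳 ⟶ S) (n : ℕ),
      IsSmoothProjectiveFamily π n → _root_.AlgebraicGeometry.Smooth S.hom →
      ∀ (s₀ : ComplexPoints S) (X₀ : SchemeOver ℂ) (e : X₀ ≅ fiberOver π s₀)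
        (E : CochainComplex X₀.left.Modules ℤ), IsBoundedVBComplex E →
        (∀ k : ℤ, k < 0 → extRank X₀ E k = 0) → HasVersalPerfectChartAt π s₀ X₀ e E)
    {d : ℕ} (hd : 0 < d) (hS : HasHyperbolicSeedOn (sigmaObjClass C) 2 d) : Stubs.WeilAlgebraicSplitHyperplane 2 d :=
  weilFourfoldsSplit_of_reach_of_pridhamPerfect_of_versalCharts_of_EGAIV4smoothAt_of_hyperbolicSeedOn hF hP
    EGAIV4_smoothAt_of_liftsAlongSmallExtensions_holds hV hd hS

/-! ## Audit: what is assumed, what is proved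
ASSUMED BY NAME: on every rung `weilFamilyReach_hyperbolic` (refereed) and `PridhamPerfectLifts C` (printed + refereed statement, venture-typed over
a real carrier, undischarged) — and the census object BY VALUE; for (E)+(C): §1 (R2) `PerfectLiftsAlgebraise π` for every smooth projective `π`
over a smooth base (Hodge-free, OBJECT level, kernel-linked to nothing); §2 (R3) the Literature named fact `EGAIV_etaleQuasiSection_of_liftsSmallExtensions`
and Lieblich-type versal charts (`HasVersalPerfectChartAt`, assembled seat corollary whose versality clause is in EXISTENCE form — weaker than Lieblich's formal smoothness, which no rung consumes (red-5 W-14) —, kernel-linked to nothing); §3 (R4) the Literature named fact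
`EGAIV4_smoothAt_of_liftsAlongSmallExtensions` ([EGAIV4] Prop. (17.14.2) alone) and the same versal charts; §4 (R5) the versal charts ALONE — both EGA
statements being seat lit-3's THEOREMS `EGAIV4_smoothAt_of_liftsAlongSmallExtensions_holds` / `EGAIV_etaleQuasiSection_of_liftsSmallExtensions_holds`.
PROVED here: nothing new — one-line compositions of seat p7's rung-R1 rows with theory seat 3's `perfectComplexAlgebraisesLifts_of_perfectLiftsAlgebraise` /
`perfectComplexAlgebraisesLifts_of_versalCharts_of_EGA` and seat lit-3's `EGAIV_etaleQuasiSection_of_liftsSmallExtensions_of_smoothAt` /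
`EGAIV4_smoothAt_of_liftsAlongSmallExtensions_holds`. NOT here: Lieblich's theorem (algebraic stack ⟹ versal chart), HC_CM, CM density,
Mumford–Tate finiteness. -/

end Summit.Ventures.HSemireg

end
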